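import Literature.IUT.HodgeTheaters.GlobalFrobenioidsArithmeticCor411
import HarnessLib

/-!
# [IUTchI] Example 5.1 (ii)/(iii): [FrdI] Corollary 4.11 ON EQUIVALENCES of `ℱ^⊛(†𝒟^⊚)` over `†𝒟^⊛ = ℬ(G_F)⁰`
# (the arithmetic model `GlobalDivisorData.arith F`, `G = G_F` itself) — HYPOTHESIS-FREE

S. Mochizuki, *Inter-universal Teichmüller theory I*, §5, Example 5.1 (ii)/(iii), kurims manuscript (May 2020)
p. 125 ([IUTchI] Ex 5.1 (iii) p.125) [claim: Mochizuki2012, status: disputed]: "`†ℱ^⊛` is equipped with a natural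
Frobenioid structure [cf. [FrdI], Corollary 4.11; [FrdI], Theorem 6.4, (i); Remark 3.1.5 of the present paper]".
The mathematics is S. Mochizuki, *The geometry of Frobenioids I*, Kyushu J. Math. **62** (2008), Cor. 4.11 pp. 91–92
[cite: MochizukiFrdI2008, Cor. 4.11 p.91] and Thm. 6.4 (i) p. 114 [cite: MochizukiFrdI2008, Thm. 6.4 (i) p.114].

PROOF-ONLY companion (cell abc-iut; seat abc-iut-w4-d109; row «C53i/M2a») of `GlobalFrobenioidsArithmeticCor411.lean`
(§1–§3 there: the composite-data lemmas, slimness of `ℬ(G)⁰`, and the results for `arithAlong F ρ hρ` over `ℬ(G)⁰`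
modulo `IsSlimGroup G`).  Here §4: the SAME results for abc-iut-L5's `GlobalDivisorData.arith F` over `ℬ(G_F)⁰`
(`GlobalFrobenioidsArithmeticModel.lean`; divisor data = L1's [FrdI] Ex. 6.3 data along the Galois-correspondence
equivalence `galoisSubextOfFinite F`) with NO hypothesis at all, `G_F` being slim ([AbsAnab] Thm. 1.1.1 (ii), PROVED in
the tree, `galoisNF_slim_holds`): standard type, not group-like, perf-factorial, rational at THE birationalization;
the TYPED [FrdI] Cor. 4.11 (ii) for every `Ψ`; `Cor411Setting`; the `1`-unique `Ψ^Base : ℬ(G_{F₁})⁰ ⥲ ℬ(G_{F₂})⁰` with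
rigid composites; "`Ψ` preserves `deg_Fr`"; and the Cor. 4.11 (iv) consumer data `(Ψ^Base, η, Ψ^Φ)`.

HONEST LIMITS as in the companion: removes the (m2) piece of the after-merge residual of `IUTchI:Cor5.3(i)` only; the
(m3) piece (Ex. 5.1 (v) / [AbsTopIII] Thm. 1.9) is FACT-policy; no node token flips.  Nothing here bears on, or takes a
side on, [IUTchIII] Cor. 3.12; nothing asserts anything about abc.
-/

noncomputable section

-- `(PreFrobenioidData.ofFunctor Φ F).base` / `ModelFrobenioid.data` unfold only at default transparency.
set_option backward.isDefEq.respectTransparency false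

namespace Literature.IUT.HodgeTheaters

open CategoryTheory Opposite NumberField
open Literature.AlgebraicGeometry.Frobenioids Literature.AnabelianGeometry.SemiGraphs
open Literature.AlgebraicGeometry.Frobenioids.QuasiTemperoid
open Literature.AlgebraicGeometry.Frobenioids.PreFrobenioid

namespace GlobalDivisorData


/-! ### §4. `ℱ^⊛(†𝒟^⊚)` over `†𝒟^⊛ = ℬ(G_F)⁰` (`arith`), hypothesis-free -/

section Arith

variable (F : Type) [Field F] [NumberField F]

/-- **`ℱ^⊛(†𝒟^⊚)` over `ℬ(G_F)⁰` is of STANDARD TYPE** ([FrdI] Thm. 6.4 (i)), unconditionally.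
([IUTchI] Ex 5.1 (ii) p.125) [claim: Mochizuki2012, status: disputed] -/
theorem isOfStandardType_arith :
    (ModelFrobenioid.data (arith F).Φ (arith F).B (arith F).div).IsOfStandardType := by
  haveI : Nonempty (BaseCat (absGalGrp F)) := (isGraphConnected_baseCat (absGalGrp F)).nonempty
  exact isOfStandardType_model_arith_comp (galoisSubextOfFinite F) (isTotallyEpimorphic_baseCat (absGalGrp F))
    (isOfFSMType_baseCat (absGalGrp F))

/-- **`ℱ^⊛(†𝒟^⊚)` over `ℬ(G_F)⁰` is NOT of group-like type.** ([IUTchI] Ex 5.1 (ii) p.125) [claim: Mochizuki2012, status: disputed] -/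
theorem not_isOfGroupLikeType_arith :
    ¬ (ModelFrobenioid.data (arith F).Φ (arith F).B (arith F).div).IsOfGroupLikeType := by
  haveI : Nonempty (BaseCat (absGalGrp F)) := (isGraphConnected_baseCat (absGalGrp F)).nonempty
  exact not_isOfGroupLikeType_model_arith_comp (galoisSubextOfFinite F)

/-- `Φ^⊛` over `ℬ(G_F)⁰` is perf-factorial objectwise. ([IUTchI] Ex 5.1 (ii) p.125) [claim: Mochizuki2012, status: disputed] -/
theorem objectwise_isPerfFactorial_arith : Objectwise (fun M _ => IsPerfFactorial M) (arith F).Φ :=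
  objectwise_isPerfFactorial_arithDivisorFunctor_comp (galoisSubextOfFinite F)

/-- Every object of `ℱ^⊛(†𝒟^⊚)` over `ℬ(G_F)⁰` is RATIONAL at THE birationalization.
([IUTchI] Ex 5.1 (ii) p.125) [claim: Mochizuki2012, status: disputed] -/
theorem isRational_biratData_arith (A : (arith F).ModelGlobalFrobenioid) :
    PreFrobenioidData.IsRational
      (biratData (isFrobenioid_arith F) (hasBiratSquares_of_isFrobenioid (isFrobenioid_arith F)))
      (S := ModelFrobenioid.data (arith F).Φ (arith F).B (arith F).div) (fun a 𝔭 => PrimarySupp a 𝔭) A :=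
  isRational_biratData_model_arith_comp (galoisSubextOfFinite F) (isFrobenioid_arith F) A

variable (F₁ : Type) [Field F₁] [NumberField F₁] (F₂ : Type) [Field F₂] [NumberField F₂]

/-- **[FrdI] Cor. 4.11 (ii) AS TYPED, UNCONDITIONALLY, for every `Ψ : ℱ^⊛(†𝒟^⊚)(F₁) ⥲ ℱ^⊛(†𝒟^⊚)(F₂)` over
`ℬ(G_{F₁})⁰`, `ℬ(G_{F₂})⁰`.** ([IUTchI] Ex 5.1 (iii) p.125) [claim: Mochizuki2012, status: disputed] -/
theorem cor411ii_arith (Ψ : (arith F₁).ModelGlobalFrobenioid ≌ (arith F₂).ModelGlobalFrobenioid) :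
    (ModelFrobenioid.data (arith F₁).Φ (arith F₁).B (arith F₁).div).Cor411ii
      (ModelFrobenioid.data (arith F₂).Φ (arith F₂).B (arith F₂).div) Ψ :=
  FrdI.cor411ii_ofFunctor (isFrobenioid_arith F₁) (isFrobenioid_arith F₂) Ψ
    (objectwise_isPerfFactorial_arith F₁) (objectwise_isPerfFactorial_arith F₂)

/-- **`Cor411Setting` HOLDS for every such `Ψ`, with NO hypothesis** (`G_{F_i}` slim: `galoisNF_slim_holds`).
([IUTchI] Ex 5.1 (iii) p.125) [claim: Mochizuki2012, status: disputed] -/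
theorem cor411Setting_arith (Ψ : (arith F₁).ModelGlobalFrobenioid ≌ (arith F₂).ModelGlobalFrobenioid) :
    (ModelFrobenioid.data (arith F₁).Φ (arith F₁).B (arith F₁).div).Cor411Setting
      (ModelFrobenioid.data (arith F₂).Φ (arith F₂).B (arith F₂).div) Ψ where
  divSlim := ⟨PreFrobenioidData.isDivSlim_of_isSlim _ (isSlim_baseCat_absGalGrp F₁),
    PreFrobenioidData.isDivSlim_of_isSlim _ (isSlim_baseCat_absGalGrp F₂)⟩
  standard := ⟨isOfStandardType_arith F₁, isOfStandardType_arith F₂⟩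
  hypB h₁ _ := absurd h₁ (not_isOfGroupLikeType_arith F₁)

/-- **The `1`-unique `Ψ^Base : ℬ(G_{F₁})⁰ ⥲ ℬ(G_{F₂})⁰` induced by `Ψ`, with NO hypothesis** ([FrdI] Cor. 4.11 (ii)
p. 91; both composites rigid). ([IUTchI] Ex 5.1 (iii) p.125) [claim: Mochizuki2012, status: disputed] -/
theorem exists_oneUniqueSquare_base_arith
    (Ψ : (arith F₁).ModelGlobalFrobenioid ≌ (arith F₂).ModelGlobalFrobenioid) :
    ∃ ΨBase : BaseCat (absGalGrp F₁) ⥤ BaseCat (absGalGrp F₂),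
      PreFrobenioidData.OneUniqueSquare Ψ.functor (arith F₁).modelBase (arith F₂).modelBase ΨBase ∧
        IsRigidFunctor (Ψ.functor ⋙ (arith F₂).modelBase) ∧ IsRigidFunctor ((arith F₁).modelBase ⋙ ΨBase) := by
  obtain ⟨ΨBase, hsq, hrig⟩ := cor411ii_arith F₁ F₂ Ψ (cor411Setting_arith F₁ F₂ Ψ)
  exact ⟨ΨBase, hsq, hrig (isSlim_baseCat_absGalGrp F₁) (isSlim_baseCat_absGalGrp F₂)⟩

/-- **"`Ψ` preserves Frobenius degrees", with NO hypothesis.** ([IUTchI] Ex 5.1 (iii) p.125) [claim: Mochizuki2012, status: disputed] -/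
theorem preservesDegFr_arith (Ψ : (arith F₁).ModelGlobalFrobenioid ≌ (arith F₂).ModelGlobalFrobenioid) :
    PreFrobenioidData.PreservesDegFr (ModelFrobenioid.data (arith F₁).Φ (arith F₁).B (arith F₁).div)
      (ModelFrobenioid.data (arith F₂).Φ (arith F₂).B (arith F₂).div) Ψ :=
  FrdI.preservesDegFr_of_cor411Setting (isFrobenioid_arith F₁) (isFrobenioid_arith F₂) Ψ
    (cor411Setting_arith F₁ F₂ Ψ)

/-- **[FrdI] Cor. 4.11 (iv), the consumer data `(Ψ^Base, η, Ψ^Φ)` at `Ψ : ℱ^⊛(†𝒟^⊚)(F₁) ⥲ ℱ^⊛(†𝒟^⊚)(F₂)`, with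
NO hypothesis** (`1`-unique base square, divisor-monoid isomorphism over `Ψ^Base`, `deg_Fr` preserved, the
divisor formula on every arrow, the typed rigidity clause, rigid composites).
([IUTchI] Ex 5.1 (iii) p.125) [claim: Mochizuki2012, status: disputed] -/
theorem exists_cor411iv_data_arith (Ψ : (arith F₁).ModelGlobalFrobenioid ≌ (arith F₂).ModelGlobalFrobenioid) :
    ∃ (ΨBase : BaseCat (absGalGrp F₁) ⥤ BaseCat (absGalGrp F₂))
      (E' : (ModelFrobenioid.data (arith F₁).Φ (arith F₁).B (arith F₁).div).DivisorMonoidIsoOverBase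
        (ModelFrobenioid.data (arith F₂).Φ (arith F₂).B (arith F₂).div) ΨBase)
      (η : Ψ.functor ⋙ (arith F₂).modelBase ≅ (arith F₁).modelBase ⋙ ΨBase),
      PreFrobenioidData.OneUniqueSquare Ψ.functor (arith F₁).modelBase (arith F₂).modelBase ΨBase ∧
      PreFrobenioidData.PreservesDegFr (ModelFrobenioid.data (arith F₁).Φ (arith F₁).B (arith F₁).div)
        (ModelFrobenioid.data (arith F₂).Φ (arith F₂).B (arith F₂).div) Ψ ∧
      (∀ ⦃A B : (arith F₁).ModelGlobalFrobenioid⦄ (φ : A ⟶ B),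
        ModelFrobenioid.div (Ψ.functor.map φ) =
          Literature.AlgebraicGeometry.Frobenioids.pull (arith F₂).Φ (η.hom.app A) (E'.iso A.base (ModelFrobenioid.div φ))) ∧
      (ModelFrobenioid.data (arith F₁).Φ (arith F₁).B (arith F₁).div).Cor411ivRigid
        (ModelFrobenioid.data (arith F₂).Φ (arith F₂).B (arith F₂).div) Ψ ΨBase E' ∧
      IsRigidFunctor (Ψ.functor ⋙ (arith F₂).modelBase) ∧ IsRigidFunctor ((arith F₁).modelBase ⋙ ΨBase) := by
  obtain ⟨ΨBase, E', η, hsq, hdeg, hdiv, hrigid, hslim⟩ :=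
    FrdI.exists_cor411iv_data_ofFunctor (isFrobenioid_arith F₁) (isFrobenioid_arith F₂)
      (objectwise_isPerfFactorial_arith F₁) (objectwise_isPerfFactorial_arith F₂)
      (isRational_biratData_arith F₁) Ψ (cor411Setting_arith F₁ F₂ Ψ)
  obtain ⟨hr₁, hr₂⟩ := hslim (isSlim_baseCat_absGalGrp F₁) (isSlim_baseCat_absGalGrp F₂)
  exact ⟨ΨBase, E', η, hsq, hdeg, hdiv, hrigid, hr₁, hr₂⟩

end Arith

end GlobalDivisorData

end Literature.IUT.HodgeTheaters

end
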